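import Summits.Ventures.HodgeRepro2.T6N41Place

/-!
# T6N41PlaceInert — the inert-place carriers of the placement (P7) (Tier 6, M2; definition lane; owner t6-p4)

Layer 2 of the placement: the objects Harris II Proposition (2.2.5)(b) and Rogawski §11.4 speak about at a
finite place `v ∉ S` of `F` INERT in `E` (`E_v/F_v` unramified quadratic, one prime `𝔓` of `E` above `v`, the
common uniformiser `ϖ = ϖ_v ∈ F_v`), over the placement datum `Pl : PlacementDatum D`:
* `RepU v` — the irreducible admissible representations of `U(W_v)` (classes), abstract; `π v` the local
  component `π_v` of the datum's `π` (side A: `π₀,v = Θ_χ(β′_v, W_{A,v})`, the local theta lift of the character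
  `β′_v` of `U(V′_v) = E¹_v`);
* `JH 𝔓 a` — the irreducible constituents of the principal series `I(χ) = i_G(χ)` of `U(W_v)` (normalised
  induction from the Levi `GL(1, K) = E_v^×` of the Borel — Harris p0095 l. 21, Rogawski §11.1) for the
  UNRAMIFIED character `χ` of `E_v^×` with `χ(ϖ) = a` (an unramified character of `E_v^×` is determined by its
  value at `ϖ`, any element of `ℂˣ`);
* `BCrog 𝔓 ρ` — Rogawski's base-change lift `ρ̃ = ψ_G(ρ)` of the L-packet `ρ` containing a member, as a
  representation of `G̃ = GL₂(E_v)` (§11.4 p0156 ll. 6–11, defined by the character identities (11.4.1));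
* `twist 𝔓 Π ξ` — the twist `Π ⊗ (ξ ∘ det)` of a representation of `GL₂(E_𝔓)` by the unramified character `ξ`
  of `E_𝔓^×` with `ξ(ϖ) = ξ`;
* the values at `ϖ_v` of the characters of (P7): `χHarris 𝔓 = (χ′/χ)(ϖ)` (Harris's character of the Levi),
  `ξV 𝔓 = χ_{V,v}(ϖ)` (the splitting character of the second lift), `γD 𝔓 = γ_{D,v}(ϖ)` (the Hecke character
  of `E` through which the split-place twist is uniform — TIER5 §N4.1.9 (A″), GR91 §3), `ωt 𝔓 = ω̃_{π}(ϖ)` with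
  `ω̃_π(z) := ω_π(z / z̄)` (E4);
* the Props `βTrivial v` («γ is trivial»: `β′_v ≡ 1`) and `thetaLift v` («`π = Θ_χ(τ, W)`»: `π_v` is the theta
  lift of `β′_v`).

The DEFINITIONAL fields say what the datum's objects are (`η₁_def`, `η₂_def`: the two Hecke characters of
(P7) are `η₂′ = γ_D χ_V`, `η₁′ = ω̃_π γ_D⁻¹ χ_V` — TIER5 §N4.1.9 (A″); `thetaLift_all`: `π₀ = Θ_{V′→W_A}(β′)`
componentwise, (N0.3) D3; `ωt_eq`: `ω̃_π(ϖ) = ω_π(ϖ/ϖ̄) = ω_π(1) = 1` since `ϖ ∈ F_v`).  The ELEMENTARY fields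
are the forcing facts F1–F3 of TIER5 (P7) in the concrete words of the carrier (an unramified character `χ` of
`E_v^×` restricted to `F_v^×` is determined by `χ(ϖ)`, `ϖ ∈ F_v^×` a common uniformiser; the unramified
quadratic character `ε_{E_v/F_v}` has `ε(ϖ) = −1`): `χHarris_eq` (Harris's standing `χ|_{F^×} = ε^{m}`,
`χ′|_{F^×} = ε^{n}` with `m = 1`, `n = 2` — p0093 l. 15, p0101 ll. 5–7 — gives `(χ′/χ)(ϖ) = ε(ϖ) = −1`),
`ξV_eq` (`χ_V|_{𝔸_F^×} = ε_{E/F}^{dim V} = ε³ = ε`, (N0.3)), `γD_eq` (`γ_D|_{𝔸_F^×} = ω_{E/F}`, GR91 Remark (1)),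
`βTrivial_of` (F1: `β′_v` unramified at `v ∉ S` and `E¹_v` compact ⇒ `β′_v ≡ 1`), `twist_ps` (`π(χ₁, χ₂) ⊗ ξ∘det
= π(χ₁ξ, χ₂ξ)`), `ps_inj` (the Satake parameters are an invariant of the nonramified principal series up to
order — Bump p0329 ll. 1–5 / (5.21)).  The one COMPAT field `BCχ_eq` identifies LR's `BC(π_v) ⊗ χ_{V,v}` (the
Satake transfer under the standard embedding, §7 ll. 12–16) with Rogawski's lift of `π_v` twisted by `χ_V`
(TIER5 §N4.1 T3 / T11 col. 5: the two base changes agree on unramified data) — class IR.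

§8(d): uses an L-value-free non-vanishing device: NO.
-/

namespace Summit.Ventures.HodgeRepro2.T6

/-- The inert-place carriers of the placement over `Pl`.  Fields are DATA, definitional links, the elementary
facts F1–F3 in the carrier's words, and one compat field; the printed theorems (Harris II (2.2.5)(b),
Rogawski §11.4) are the displays of `T6N41PlaceInertHyp.lean`. -/
structure InertDatum {ι : Type*} {D : DoublingLDatum ι} (Pl : PlacementDatum D) where
  /-- «`𝔓` is inert»: the place `b 𝔓` of `F` is inert in `E` (`E_v/F_v` unramified quadratic, `𝔓` the unique
  prime above it) -/
  inert : Pl.κ → Prop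
  /-- the irreducible admissible representations of `U(W_v)` (classes), abstract -/
  RepU : ι → Type
  /-- `π_v`, the local component of the datum's `π` at `v` -/
  π : ∀ v, RepU v
  /-- the irreducible constituents `JH(I(χ))` of the principal series of `U(W_v)` induced from the unramified
  character `χ` of the Levi `E_v^×` with `χ(ϖ_v) = a` -/
  JH : ∀ 𝔓, ℂˣ → Set (RepU (Pl.b 𝔓))
  /-- Rogawski's base-change lift `ρ̃ = ψ_G(ρ)` of the packet of a member, a representation of `GL₂(E_v)` -/
  BCrog : ∀ 𝔓, RepU (Pl.b 𝔓) → Pl.RepGL 𝔓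
  /-- the twist `Π ⊗ (ξ ∘ det)` of a representation of `GL₂(E_𝔓)` by the unramified character with
  `ξ(ϖ) = ξ` -/
  twist : ∀ 𝔓, Pl.RepGL 𝔓 → ℂˣ → Pl.RepGL 𝔓
  /-- [elementary] `π(χ₁, χ₂) ⊗ (ξ ∘ det) = π(χ₁ ξ, χ₂ ξ)` on Satake parameters -/
  twist_ps : ∀ 𝔓 (a b ξ : ℂˣ), twist 𝔓 (Pl.ps 𝔓 a b) ξ = Pl.ps 𝔓 (a * ξ) (b * ξ)
  /-- [elementary; Bump p0329 ll. 1–5, (5.21)] the Satake parameters are an invariant of the nonramified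
  principal series up to order -/
  ps_inj : ∀ 𝔓 (a b c d : ℂˣ), Pl.ps 𝔓 a b = Pl.ps 𝔓 c d → (a = c ∧ b = d) ∨ (a = d ∧ b = c)
  /-- `(χ′/χ)(ϖ_v)`, Harris's character of the Levi `GL(1, K)` at the uniformiser -/
  χHarris : Pl.κ → ℂˣ
  /-- `χ_{V,v}(ϖ_v)` -/
  ξV : Pl.κ → ℂˣ
  /-- `γ_{D,v}(ϖ_v)`, the Hecke character of TIER5 §N4.1.9 (A″) at the uniformiser -/
  γD : Pl.κ → ℂˣ
  /-- `ω̃_π(ϖ_v)` where `ω̃_π(z) = ω_π(z / z̄)` (E4), `ω_π` the central character -/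
  ωt : Pl.κ → ℂˣ
  /-- «`γ` is trivial»: `β′_v ≡ 1` -/
  βTrivial : ι → Prop
  /-- «`π = Θ_χ(τ, W)`»: `π_v` is the local theta lift of the character `τ = γ = β′_v` of `H = U(V′_v)` to
  `G = U(W_v)` with splitting characters `(χ, χ′)` -/
  thetaLift : ι → Prop
  /-- [definitional (N0.3) D3] `π₀ = Θ_{V′→W_A}(β′)` componentwise: `π_v` is the local theta lift of `β′_v` at
  every place -/
  thetaLift_all : ∀ v, thetaLift v
  /-- [elementary F1] at an inert `v ∉ S` the character `β′_v` of the compact group `E¹_v` is unramified (`v ∉ S`),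
  hence trivial -/
  βTrivial_of : ∀ 𝔓, inert 𝔓 → Pl.b 𝔓 ∉ D.S → βTrivial (Pl.b 𝔓)
  /-- [elementary F3; Harris p0093 l. 15 / p0101 ll. 5–7] `(χ′/χ)|_{F_v^×} = ε^{n−m} = ε_{E_v/F_v}` (`n = 2`,
  `m = 1`), unramified: `(χ′/χ)(ϖ) = ε(ϖ) = −1` -/
  χHarris_eq : ∀ 𝔓, inert 𝔓 → Pl.b 𝔓 ∉ D.S → χHarris 𝔓 = -1
  /-- [elementary F3; (N0.3)] `χ_V|_{𝔸_F^×} = ε_{E/F}^{3} = ε_{E/F}`, unramified at `v ∉ S`: `χ_{V,v}(ϖ) = −1` -/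
  ξV_eq : ∀ 𝔓, inert 𝔓 → Pl.b 𝔓 ∉ D.S → ξV 𝔓 = -1
  /-- [elementary F3; GR91 Remark (1)] `γ_D|_{𝔸_F^×} = ω_{E/F}`, unramified at `v ∉ S`: `γ_{D,v}(ϖ) = −1` -/
  γD_eq : ∀ 𝔓, inert 𝔓 → Pl.b 𝔓 ∉ D.S → γD 𝔓 = -1
  /-- [definitional E4] `ω̃_π(ϖ) = ω_π(ϖ / ϖ̄) = ω_π(1) = 1` (`ϖ ∈ F_v`) -/
  ωt_eq : ∀ 𝔓, inert 𝔓 → ωt 𝔓 = 1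
  /-- [definitional (A″)] `η₂′ = γ_D χ_V` at `𝔓` -/
  η₂_def : ∀ 𝔓, inert 𝔓 → Pl.b 𝔓 ∉ D.S → Pl.η₂ 𝔓 = γD 𝔓 * ξV 𝔓
  /-- [definitional (A″)] `η₁′ = ω̃_π γ_D⁻¹ χ_V` at `𝔓` -/
  η₁_def : ∀ 𝔓, inert 𝔓 → Pl.b 𝔓 ∉ D.S → Pl.η₁ 𝔓 = ωt 𝔓 * (γD 𝔓)⁻¹ * ξV 𝔓
  /-- [compat; class IR] at an inert `v ∉ S`, LR's `BC(π_v) ⊗ χ_{V,v}` (the Satake transfer under the standard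
  embedding) is Rogawski's lift of `π_v` twisted by `χ_{V,v}` (TIER5 §N4.1 T3 / T11 col. 5) -/
  BCχ_eq : ∀ 𝔓, inert 𝔓 → Pl.b 𝔓 ∉ D.S → Pl.BCχ 𝔓 = twist 𝔓 (BCrog 𝔓 (π (Pl.b 𝔓))) (ξV 𝔓)

namespace InertDatum

variable {ι : Type*} {D : DoublingLDatum ι} {Pl : PlacementDatum D} (In : InertDatum Pl)

/-- At an inert prime off `S` both Hecke values are `1`: `η₂′(𝔓) = γ_D(ϖ) χ_V(ϖ) = (−1)(−1) = 1`,
`η₁′(𝔓) = ω̃(ϖ) γ_D(ϖ)⁻¹ χ_V(ϖ) = 1 · (−1)⁻¹ · (−1) = 1` (TIER5 (P7) FORCING READ BACK). -/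
theorem η_eq_one (𝔓 : Pl.κ) (hi : In.inert 𝔓) (hS : Pl.b 𝔓 ∉ D.S) : Pl.η₁ 𝔓 = 1 ∧ Pl.η₂ 𝔓 = 1 := by
  constructor
  · rw [In.η₁_def 𝔓 hi hS, In.ωt_eq 𝔓 hi, In.γD_eq 𝔓 hi hS, In.ξV_eq 𝔓 hi hS]
    simp
  · rw [In.η₂_def 𝔓 hi hS, In.γD_eq 𝔓 hi hS, In.ξV_eq 𝔓 hi hS]
    simp

end InertDatum

end Summit.Ventures.HodgeRepro2.T6
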